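import Summits.CriticalPhenomena.Ising3D.IsingStripL11
import HarnessLib

/-!
# F-CP1: kernel-checkable certificates for the three rational fields of `StripCertificatesL11 stair cover`
# (`stair_sup`, `stair_sub`, `covers`) and for the `covers` field of `IslandCertificatesL19`
(cell `crit-ising-boot`, seat typing-1; PRE-REG v5 `b8848a1d5c9e4d5a` §(1a)/(1b), AMEND-6; the owner's «sound grid
`coverCheck` WANTED» of 2026-08-28T17:32:38Z, Q3)

HONEST FRAMING: lottery ticket; floor = tightest certified 3D Ising CFT bounds; floating SDPB islands are not
certificates; nothing here is a bootstrap certificate — this file is about the elementary cover step only.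

Once the lead's dyadic staircase `S₁₁^□ = ⋃ stair` and the producers' tiling `cover` are hash-rowed, the fields
`stair_sup : S₁₁ ⊆ ⋃ stair`, `stair_sub : ⋃ stair ⊆ S₁₁plus`, `covers : W₁₁ \ (B₁₁ ∪ ⋃ stair) ⊆ ⋃ cover` are
statements of exact rational arithmetic with `O(10²–10³)` boxes. This file makes each of them ONE `decide +kernel`:

* `CoverCert` — a binary space-partition certificate over a window: nodes `splitσ x l r` / `splitε y l r` cut the
  current region at a rational abscissa / ordinate; leaves are `tile` («this region lies in the NEXT box of the
  tile list» — the list is consumed depth-first, a tile listed once per leaf it contains), `inU k` («this region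
  lies in the `k`-th box of the un-excluded list `ub`», here `B₁₁ :: stair`, `[B₁₉]` or `stair`), `outS i` («this
  region lies STRICTLY outside constraint `i` of the slanted band»: `i = 0` left of the cut, `i = 1` above the
  upper edge, `i = 2` below the lower edge — a strict affine inequality at the four corners of a box holds on
  the box, `affine_lt_of_corners`);
* `CoverCert.run ub S c R l : Option (List BoxQ)` — the rational check, LINEAR in |certificate| + |tile list|
  (no indexing into the long list), returning the unconsumed tiles; soundness `CoverCert.subset_of_run`:
  success ⇒ `R ⊆ ⋃ ub ∪ (band core)ᶜ ∪ ⋃ l`;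
* the generic dischargers `CoverCert.diff_subset_of_run` (cover form: `W \ ⋃ ub ⊆ ⋃ cover`),
  `CoverCert.band_subset_of_run` (band form: `band ∩ W ⊆ ⋃ ub`), `iUnion_subset_of_stairSubCheck` (`stair.all`:
  window containment + four-corner membership in a convex band, exact by `StripQ.toSet_subset_of_corners`), and
  the island form `islandCovers_of_cert` / `islandCertificatesL19_of_cert` (`ub = [B₁₉]`). The F-CP1 strip
  instances (`W₁₁`, `B₁₁`, `S₁₁`, `S₁₁plus` as rational data and the three dischargers of `StripCertificatesL11`)
  are the sibling `IsingStripL11Checks`.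
Sufficient criteria, complete for the intended inputs (any finite closed-box tiling admits a `covers` certificate
after refining along tile edges; a dyadic staircase admits a `stair_sup` certificate since the band's slanted edges
and its cut `521/1000` avoid `(2⁻¹¹ℤ)²`). Reference generator: typing-1's `covercert_gen.py` (cell HOME); scale
tests in `IsingStripL11Checks`. Elementary; no analysis; nothing about the Ising CFT. [folklore]
-/

namespace Summit.CriticalPhenomena.Ising3D

open Set Literature.MathematicalPhysics.QuantumFieldTheory.ConformalBootstrap3D

/-! ### Rational containment checks -/

/-- `T.containsB R`: the rational box `R` lies inside the rational box `T` (four comparisons). [folklore] -/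
def BoxQ.containsB (T R : BoxQ) : Bool :=
  decide (T.σlo ≤ R.σlo) && decide (R.σhi ≤ T.σhi) && decide (T.εlo ≤ R.εlo) && decide (R.εhi ≤ T.εhi)

/-- Soundness of `containsB`. [folklore] -/
theorem BoxQ.toSet_subset_of_containsB {T R : BoxQ} (h : T.containsB R = true) : R.toSet ⊆ T.toSet := by
  simp only [BoxQ.containsB, Bool.and_eq_true, decide_eq_true_eq] at h
  obtain ⟨⟨⟨h1, h2⟩, h3⟩, h4⟩ := h
  rintro ⟨σ, ε⟩ hp
  obtain ⟨g1, g2, g3, g4⟩ := BoxQ.bounds hp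
  have h1' : ((T.σlo : ℚ) : ℝ) ≤ R.σlo := by exact_mod_cast h1
  have h2' : ((R.σhi : ℚ) : ℝ) ≤ T.σhi := by exact_mod_cast h2
  have h3' : ((T.εlo : ℚ) : ℝ) ≤ R.εlo := by exact_mod_cast h3
  have h4' : ((R.εhi : ℚ) : ℝ) ≤ T.εhi := by exact_mod_cast h4
  exact mk_mem_prod ⟨h1'.trans g1, g2.trans h2'⟩ ⟨h3'.trans g3, g4.trans h4'⟩

/-- An affine inequality `a x + b y ≤ c` that holds at the four corners of a box holds on the box (the box is
the convex hull of its corners; here by a sign case split). [folklore] -/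
theorem affine_le_of_corners {a b c : ℝ} (R : BoxQ) (h1 : a * R.σlo + b * R.εlo ≤ c)
    (h2 : a * R.σlo + b * R.εhi ≤ c) (h3 : a * R.σhi + b * R.εlo ≤ c) (h4 : a * R.σhi + b * R.εhi ≤ c) :
    ∀ p ∈ R.toSet, a * p.1 + b * p.2 ≤ c := by
  rintro ⟨x, y⟩ hp
  obtain ⟨g1, g2, g3, g4⟩ := BoxQ.bounds hp
  simp only at g1 g2 g3 g4 ⊢
  have hx : a * x ≤ a * R.σlo ∨ a * x ≤ a * R.σhi := by
    rcases le_or_gt 0 a with ha | ha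
    · exact Or.inr (mul_le_mul_of_nonneg_left g2 ha)
    · exact Or.inl (by nlinarith)
  have hy : b * y ≤ b * R.εlo ∨ b * y ≤ b * R.εhi := by
    rcases le_or_gt 0 b with hb | hb
    · exact Or.inr (mul_le_mul_of_nonneg_left g4 hb)
    · exact Or.inl (by nlinarith)
  rcases hx with hx | hx <;> rcases hy with hy | hy <;> linarith

/-- The strict version: `a x + b y < c` at the four corners of a box holds on the box. [folklore] -/
theorem affine_lt_of_corners {a b c : ℝ} (R : BoxQ) (h1 : a * R.σlo + b * R.εlo < c)
    (h2 : a * R.σlo + b * R.εhi < c) (h3 : a * R.σhi + b * R.εlo < c) (h4 : a * R.σhi + b * R.εhi < c) :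
    ∀ p ∈ R.toSet, a * p.1 + b * p.2 < c := by
  rintro ⟨x, y⟩ hp
  obtain ⟨g1, g2, g3, g4⟩ := BoxQ.bounds hp
  simp only at g1 g2 g3 g4 ⊢
  have hx : a * x ≤ a * R.σlo ∨ a * x ≤ a * R.σhi := by
    rcases le_or_gt 0 a with ha | ha
    · exact Or.inr (mul_le_mul_of_nonneg_left g2 ha)
    · exact Or.inl (by nlinarith)
  have hy : b * y ≤ b * R.εlo ∨ b * y ≤ b * R.εhi := by
    rcases le_or_gt 0 b with hb | hb
    · exact Or.inr (mul_le_mul_of_nonneg_left g4 hb)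
    · exact Or.inl (by nlinarith)
  rcases hx with hx | hx <;> rcases hy with hy | hy <;> linarith

/-! ### Slanted bands as rational data -/

/-- Rational data of a slanted band: `{p | s0 ≤ p.1 ∧ |p.2 − (c0 + m (p.1 − x0))| ≤ w}` (cut from a window) —
the shape of `StripL11.S₁₁` (`s0 = 521/1000`, `w = 3/100`) and `StripL11.S₁₁plus` (`519/1000`, `1/25`), both with
`c0 = 36/25`, `m = 24/5`, `x0 = 209/400`. [folklore] -/
structure StripQ where
  /-- left cut `s0 ≤ Δσ` -/
  s0 : ℚ
  /-- centre-line value at `x0` -/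
  c0 : ℚ
  /-- slope -/
  m : ℚ
  /-- abscissa of reference -/
  x0 : ℚ
  /-- half-width in `Δε` -/
  w : ℚ

/-- The band's core (no window clause): `{p | s0 ≤ p.1 ∧ |p.2 − (c0 + m (p.1 − x0))| ≤ w}`. [folklore] -/
def StripQ.core (S : StripQ) : Set (ℝ × ℝ) :=
  {p | (S.s0 : ℝ) ≤ p.1 ∧ |p.2 - (S.c0 + S.m * (p.1 - S.x0))| ≤ S.w}

/-- The band as a set, cut from the window `W`. [folklore] -/
def StripQ.toSet (S : StripQ) (W : BoxQ) : Set (ℝ × ℝ) := {p ∈ W.toSet | p ∈ S.core}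

/-- Rational membership test of a corner `(x, y)` in the band's core. [folklore] -/
def StripQ.memQ (S : StripQ) (x y : ℚ) : Bool :=
  decide (S.s0 ≤ x) && decide (y - (S.c0 + S.m * (x - S.x0)) ≤ S.w) &&
    decide (-S.w ≤ y - (S.c0 + S.m * (x - S.x0)))

/-- The three affine forms of the band condition at a rational corner, over `ℝ`. [folklore] -/
theorem StripQ.affine_of_memQ (S : StripQ) {x y : ℚ} (h : S.memQ x y = true) :
    (-1) * (x : ℝ) + 0 * (y : ℝ) ≤ -S.s0 ∧
      (-(S.m : ℝ)) * x + 1 * y ≤ S.w + S.c0 - S.m * S.x0 ∧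
        (S.m : ℝ) * x + (-1) * y ≤ S.w - S.c0 + S.m * S.x0 := by
  simp only [StripQ.memQ, Bool.and_eq_true, decide_eq_true_eq] at h
  obtain ⟨⟨h1, h2⟩, h3⟩ := h
  have h1' : ((S.s0 : ℚ) : ℝ) ≤ x := by exact_mod_cast h1
  have h2' : ((y - (S.c0 + S.m * (x - S.x0)) : ℚ) : ℝ) ≤ S.w := by exact_mod_cast h2
  have h3' : ((-S.w : ℚ) : ℝ) ≤ ((y - (S.c0 + S.m * (x - S.x0)) : ℚ) : ℝ) := by exact_mod_cast h3
  push_cast at h2' h3'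
  refine ⟨by linarith, by linarith, by linarith⟩

/-- **Convexity of the band**: a rational box inside `W` whose four corners pass `memQ` lies in the band.
[folklore] -/
theorem StripQ.toSet_subset_of_corners (S : StripQ) {W R : BoxQ} (hW : W.containsB R = true)
    (c1 : S.memQ R.σlo R.εlo = true) (c2 : S.memQ R.σlo R.εhi = true) (c3 : S.memQ R.σhi R.εlo = true)
    (c4 : S.memQ R.σhi R.εhi = true) : R.toSet ⊆ S.toSet W := by
  intro p hp
  obtain ⟨a1, a2, a3⟩ := S.affine_of_memQ c1
  obtain ⟨b1, b2, b3⟩ := S.affine_of_memQ c2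
  obtain ⟨d1, d2, d3⟩ := S.affine_of_memQ c3
  obtain ⟨e1, e2, e3⟩ := S.affine_of_memQ c4
  have i1 := affine_le_of_corners R a1 b1 d1 e1 p hp
  have i2 := affine_le_of_corners R a2 b2 d2 e2 p hp
  have i3 := affine_le_of_corners R a3 b3 d3 e3 p hp
  exact ⟨BoxQ.toSet_subset_of_containsB hW hp, by linarith, abs_le.mpr ⟨by linarith, by linarith⟩⟩

/-- Rational test «the box `R` is STRICTLY OUTSIDE constraint `i` of the band» (`i = 0`: `R.σhi < s0`; `i = 1`: the
four corners strictly above the upper edge; `i = 2`: strictly below the lower edge; other `i` fail). [folklore] -/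
def StripQ.outQ (S : StripQ) (i : ℕ) (R : BoxQ) : Bool :=
  match i with
  | 0 => decide (R.σhi < S.s0)
  | 1 => decide (S.w < R.εlo - (S.c0 + S.m * (R.σlo - S.x0))) &&
      decide (S.w < R.εlo - (S.c0 + S.m * (R.σhi - S.x0))) &&
      decide (S.w < R.εhi - (S.c0 + S.m * (R.σlo - S.x0))) &&
      decide (S.w < R.εhi - (S.c0 + S.m * (R.σhi - S.x0)))
  | 2 => decide (R.εlo - (S.c0 + S.m * (R.σlo - S.x0)) < -S.w) &&
      decide (R.εlo - (S.c0 + S.m * (R.σhi - S.x0)) < -S.w) &&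
      decide (R.εhi - (S.c0 + S.m * (R.σlo - S.x0)) < -S.w) &&
      decide (R.εhi - (S.c0 + S.m * (R.σhi - S.x0)) < -S.w)
  | _ => false

/-- Soundness of `outQ`: the box misses the band's core. [folklore] -/
theorem StripQ.disjoint_core_of_outQ (S : StripQ) {i : ℕ} {R : BoxQ} (h : S.outQ i R = true) :
    ∀ p ∈ R.toSet, p ∉ S.core := by
  intro p hp hcore
  obtain ⟨hs, habs⟩ := hcore
  obtain ⟨hlo, hhi⟩ := abs_le.mp habs
  obtain ⟨g1, g2, g3, g4⟩ := BoxQ.bounds hp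
  match i, h with
  | 0, h =>
    simp only [StripQ.outQ, decide_eq_true_eq] at h
    have h' : ((R.σhi : ℚ) : ℝ) < S.s0 := by exact_mod_cast h
    linarith
  | 1, h =>
    simp only [StripQ.outQ, Bool.and_eq_true, decide_eq_true_eq] at h
    obtain ⟨⟨⟨k1, k2⟩, k3⟩, k4⟩ := h
    have k1' : ((S.w : ℚ) : ℝ) < ((R.εlo - (S.c0 + S.m * (R.σlo - S.x0)) : ℚ) : ℝ) := by exact_mod_cast k1
    have k2' : ((S.w : ℚ) : ℝ) < ((R.εlo - (S.c0 + S.m * (R.σhi - S.x0)) : ℚ) : ℝ) := by exact_mod_cast k2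
    have k3' : ((S.w : ℚ) : ℝ) < ((R.εhi - (S.c0 + S.m * (R.σlo - S.x0)) : ℚ) : ℝ) := by exact_mod_cast k3
    have k4' : ((S.w : ℚ) : ℝ) < ((R.εhi - (S.c0 + S.m * (R.σhi - S.x0)) : ℚ) : ℝ) := by exact_mod_cast k4
    push_cast at k1' k2' k3' k4'
    have := affine_lt_of_corners (a := (S.m : ℝ)) (b := -1) (c := S.m * S.x0 - S.c0 - S.w) R
      (by linarith) (by linarith) (by linarith) (by linarith) p hp
    linarith
  | 2, h =>
    simp only [StripQ.outQ, Bool.and_eq_true, decide_eq_true_eq] at h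
    obtain ⟨⟨⟨k1, k2⟩, k3⟩, k4⟩ := h
    have k1' : ((R.εlo - (S.c0 + S.m * (R.σlo - S.x0)) : ℚ) : ℝ) < ((-S.w : ℚ) : ℝ) := by exact_mod_cast k1
    have k2' : ((R.εlo - (S.c0 + S.m * (R.σhi - S.x0)) : ℚ) : ℝ) < ((-S.w : ℚ) : ℝ) := by exact_mod_cast k2
    have k3' : ((R.εhi - (S.c0 + S.m * (R.σlo - S.x0)) : ℚ) : ℝ) < ((-S.w : ℚ) : ℝ) := by exact_mod_cast k3
    have k4' : ((R.εhi - (S.c0 + S.m * (R.σhi - S.x0)) : ℚ) : ℝ) < ((-S.w : ℚ) : ℝ) := by exact_mod_cast k4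
    push_cast at k1' k2' k3' k4'
    have := affine_lt_of_corners (a := -(S.m : ℝ)) (b := 1) (c := S.c0 - S.m * S.x0 - S.w) R
      (by linarith) (by linarith) (by linarith) (by linarith) p hp
    linarith
  | (n + 3), h => simp [StripQ.outQ] at h

/-- The complement of the band's core, or nothing when no band is given. [folklore] -/
def bandCompl : Option StripQ → Set (ℝ × ℝ) := fun S => S.elim ∅ fun S => S.coreᶜ

/-! ### Cover certificates -/

/-- **A binary space-partition certificate.** Leaves: `tile` — the current region lies in the NEXT box of the
tile list (consumed depth-first); `inU k` — it lies in the `k`-th box of the (short) un-excluded list; `outS i` —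
it lies strictly outside constraint `i` of the band. Nodes: `splitσ x l r` — cut at `Δσ = x` into a left part
(certificate `l`) and a right part (`r`); `splitε y l r` — cut at `Δε = y` into lower / upper. [folklore] -/
inductive CoverCert where
  /-- leaf: region inside the next tile of the tile list -/
  | tile : CoverCert
  /-- leaf: region inside the `k`-th un-excluded box -/
  | inU (k : ℕ) : CoverCert
  /-- leaf: region strictly outside constraint `i` of the band -/
  | outS (i : ℕ) : CoverCert
  /-- node: cut at `Δσ = x` -/
  | splitσ (x : ℚ) (l r : CoverCert) : CoverCert
  /-- node: cut at `Δε = y` -/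
  | splitε (y : ℚ) (l r : CoverCert) : CoverCert

/-- **Running a certificate on a region `R` against a tile list** (structural recursion on the certificate;
linear in |certificate| + |list|): returns the unconsumed rest of the list, or `none` on failure. [folklore] -/
def CoverCert.run (ub : List BoxQ) (S : Option StripQ) : CoverCert → BoxQ → List BoxQ → Option (List BoxQ)
  | .tile, _, [] => none
  | .tile, R, T :: rest => bif T.containsB R then some rest else none
  | .inU k, R, l =>
    match ub[k]? with
    | none => none
    | some T => bif T.containsB R then some l else none
  | .outS i, R, l =>
    match S with
    | none => none
    | some S => bif S.outQ i R then some l else none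
  | .splitσ x c₁ c₂, R, l =>
    match CoverCert.run ub S c₁ ⟨R.σlo, x, R.εlo, R.εhi⟩ l with
    | none => none
    | some l₁ => CoverCert.run ub S c₂ ⟨x, R.σhi, R.εlo, R.εhi⟩ l₁
  | .splitε y c₁ c₂, R, l =>
    match CoverCert.run ub S c₁ ⟨R.σlo, R.σhi, R.εlo, y⟩ l with
    | none => none
    | some l₁ => CoverCert.run ub S c₂ ⟨R.σlo, R.σhi, y, R.εhi⟩ l₁

/-- **Soundness of the run** (the invariant): if `c.run ub S R l = some l'` then `l' ⊆ l` and every point of `R`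
lies in an un-excluded box, or outside the band's core, or in a box of `l`. Induction on `c`; the cuts need no
side condition (a point of `R` with `Δσ ≤ x` lies in the left part, otherwise in the right part). [folklore] -/
theorem CoverCert.subset_of_run (ub : List BoxQ) (S : Option StripQ) :
    ∀ (c : CoverCert) (R : BoxQ) (l l' : List BoxQ), c.run ub S R l = some l' →
      (∀ Q ∈ l', Q ∈ l) ∧
        R.toSet ⊆ ((⋃ Q ∈ ub, Q.toSet) ∪ bandCompl S) ∪ ⋃ Q ∈ l, Q.toSet := by
  intro c
  induction c with
  | tile =>
    intro R l l' h
    cases l with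
    | nil => simp [CoverCert.run] at h
    | cons T rest =>
      simp only [CoverCert.run] at h
      cases hT : T.containsB R with
      | false => simp [hT] at h
      | true =>
        simp only [hT, cond_true, Option.some.injEq] at h
        subst h
        refine ⟨fun Q hQ => List.mem_cons_of_mem T hQ, fun p hp => Or.inr ?_⟩
        exact mem_iUnion₂.mpr ⟨T, List.mem_cons_self, BoxQ.toSet_subset_of_containsB hT hp⟩
  | inU k =>
    intro R l l' h
    simp only [CoverCert.run] at h
    cases hk : ub[k]? with
    | none => rw [hk] at h; simp at h
    | some T =>
      rw [hk] at h
      simp only at h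
      cases hT : T.containsB R with
      | false => simp [hT] at h
      | true =>
        simp only [hT, cond_true, Option.some.injEq] at h
        subst h
        refine ⟨fun Q hQ => hQ, fun p hp => Or.inl (Or.inl ?_)⟩
        exact mem_iUnion₂.mpr ⟨T, List.mem_of_getElem? hk, BoxQ.toSet_subset_of_containsB hT hp⟩
  | outS i =>
    intro R l l' h
    cases S with
    | none => simp [CoverCert.run] at h
    | some S =>
      simp only [CoverCert.run] at h
      cases ho : S.outQ i R with
      | false => rw [ho] at h; simp at h
      | true =>
        rw [ho] at h
        simp only [cond_true, Option.some.injEq] at h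
        subst h
        exact ⟨fun Q hQ => hQ, fun p hp => Or.inl (Or.inr (S.disjoint_core_of_outQ ho p hp))⟩
  | splitσ x c₁ c₂ ih₁ ih₂ =>
    intro R l l' h
    simp only [CoverCert.run] at h
    cases h₁ : c₁.run ub S ⟨R.σlo, x, R.εlo, R.εhi⟩ l with
    | none => rw [h₁] at h; simp at h
    | some l₁ =>
      rw [h₁] at h
      simp only at h
      obtain ⟨sub₁, cov₁⟩ := ih₁ _ _ _ h₁
      obtain ⟨sub₂, cov₂⟩ := ih₂ _ _ _ h
      refine ⟨fun Q hQ => sub₁ Q (sub₂ Q hQ), fun p hp => ?_⟩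
      obtain ⟨g1, g2, g3, g4⟩ := BoxQ.bounds hp
      rcases le_total p.1 (x : ℝ) with hx | hx
      · exact cov₁ (mk_mem_prod ⟨g1, hx⟩ ⟨g3, g4⟩)
      · rcases cov₂ (mk_mem_prod ⟨hx, g2⟩ ⟨g3, g4⟩) with h' | h'
        · exact Or.inl h'
        · rw [mem_iUnion₂] at h'
          obtain ⟨Q, hQ, hpQ⟩ := h'
          exact Or.inr (mem_iUnion₂.mpr ⟨Q, sub₁ Q hQ, hpQ⟩)
  | splitε y c₁ c₂ ih₁ ih₂ =>
    intro R l l' h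
    simp only [CoverCert.run] at h
    cases h₁ : c₁.run ub S ⟨R.σlo, R.σhi, R.εlo, y⟩ l with
    | none => rw [h₁] at h; simp at h
    | some l₁ =>
      rw [h₁] at h
      simp only at h
      obtain ⟨sub₁, cov₁⟩ := ih₁ _ _ _ h₁
      obtain ⟨sub₂, cov₂⟩ := ih₂ _ _ _ h
      refine ⟨fun Q hQ => sub₁ Q (sub₂ Q hQ), fun p hp => ?_⟩
      obtain ⟨g1, g2, g3, g4⟩ := BoxQ.bounds hp
      rcases le_total p.2 (y : ℝ) with hy | hy
      · exact cov₁ (mk_mem_prod ⟨g1, g2⟩ ⟨g3, hy⟩)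
      · rcases cov₂ (mk_mem_prod ⟨g1, g2⟩ ⟨hy, g4⟩) with h' | h'
        · exact Or.inl h'
        · rw [mem_iUnion₂] at h'
          obtain ⟨Q, hQ, hpQ⟩ := h'
          exact Or.inr (mem_iUnion₂.mpr ⟨Q, sub₁ Q hQ, hpQ⟩)

/-- **Cover form**: a successful run with no band gives `W \ ⋃ ub ⊆ ⋃ cover`. [folklore] -/
theorem CoverCert.diff_subset_of_run (ub : List BoxQ) (W : BoxQ) (cover : List BoxQ) (c : CoverCert)
    (h : (c.run ub none W cover).isSome = true) :
    W.toSet \ (⋃ Q ∈ ub, Q.toSet) ⊆ ⋃ Q ∈ cover, Q.toSet := by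
  obtain ⟨l', hl'⟩ := Option.isSome_iff_exists.mp h
  intro p hp
  rcases (CoverCert.subset_of_run ub none c W cover l' hl').2 hp.1 with (h' | h') | h'
  · exact absurd h' hp.2
  · simp [bandCompl] at h'
  · exact h'

/-- **Band form**: a successful run with no tiles gives `band ∩ W ⊆ ⋃ ub` (the band inside the window is covered
by the un-excluded boxes). [folklore] -/
theorem CoverCert.band_subset_of_run (ub : List BoxQ) (S : StripQ) (W : BoxQ) (c : CoverCert)
    (h : (c.run ub (some S) W []).isSome = true) : S.toSet W ⊆ ⋃ Q ∈ ub, Q.toSet := by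
  obtain ⟨l', hl'⟩ := Option.isSome_iff_exists.mp h
  intro p hp
  rcases (CoverCert.subset_of_run ub (some S) c W [] l' hl').2 hp.1 with (h' | h') | h'
  · exact h'
  · exact absurd hp.2 h'
  · simp at h'

/-- Rational check of «every box of `stair` lies in the window and has its four corners in the band `S`».
[folklore] -/
def stairSubCheck (W : BoxQ) (S : StripQ) (stair : List BoxQ) : Bool :=
  stair.all fun Q =>
    W.containsB Q && S.memQ Q.σlo Q.εlo && S.memQ Q.σlo Q.εhi && S.memQ Q.σhi Q.εlo && S.memQ Q.σhi Q.εhi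

/-- Soundness of `stairSubCheck`: `⋃ stair ⊆ S.toSet W` (convexity of the band). [folklore] -/
theorem iUnion_subset_of_stairSubCheck {W : BoxQ} {S : StripQ} {stair : List BoxQ}
    (h : stairSubCheck W S stair = true) : (⋃ Q ∈ stair, Q.toSet) ⊆ S.toSet W := by
  intro p hp
  rw [mem_iUnion₂] at hp
  obtain ⟨Q, hQ, hpQ⟩ := hp
  simp only [stairSubCheck, List.all_eq_true, Bool.and_eq_true] at h
  obtain ⟨⟨⟨⟨hW, c1⟩, c2⟩, c3⟩, c4⟩ := h Q hQ
  exact S.toSet_subset_of_corners hW c1 c2 c3 c4 hpQ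

/-! ### Island form -/

/-- **Island `covers` by certificate**: `ub = [B₁₉]`, no band. [folklore] -/
theorem islandCovers_of_cert (W₁₉ B₁₉ : BoxQ) (cover : List BoxQ) (c : CoverCert)
    (h : (c.run [B₁₉] none W₁₉ cover).isSome = true) : W₁₉.toSet \ B₁₉.toSet ⊆ ⋃ Q ∈ cover, Q.toSet := by
  have := CoverCert.diff_subset_of_run [B₁₉] W₁₉ cover c h
  simpa using this

/-- `IslandCertificatesL19` from its ingredients with the cover obligation by certificate. [folklore] -/
theorem islandCertificatesL19_of_cert {W₁₉ B₁₉ : BoxQ} {cover : List BoxQ} (c : CoverCert)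
    (hin : B₁₉.StrictInside W₁₉) (h : (c.run [B₁₉] none W₁₉ cover).isSome = true)
    (hex : ∀ Q ∈ cover, BoxExcluded Q.toSet) : IslandCertificatesL19 W₁₉ B₁₉ cover :=
  ⟨hin, islandCovers_of_cert W₁₉ B₁₉ cover c h, hex⟩

/-- Smoke test (`decide +kernel`): the toy island cover of `IsingStripL11Instances` (window `[0, 3/8]²`, inner
box `[1/8, 1/4]²`, four flanking tiles listed depth-first: bottom, left, right, top). [folklore] -/
theorem coverCert_toy_check :
    ((CoverCert.splitε (1 / 8) .tile
        (.splitε (1 / 4) (.splitσ (1 / 8) .tile (.splitσ (1 / 4) (.inU 0) .tile)) .tile)).run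
      [⟨1 / 8, 1 / 4, 1 / 8, 1 / 4⟩] none ⟨0, 3 / 8, 0, 3 / 8⟩
      [⟨0, 3 / 8, 0, 1 / 8⟩, ⟨0, 1 / 8, 0, 3 / 8⟩, ⟨1 / 4, 3 / 8, 0, 3 / 8⟩, ⟨0, 3 / 8, 1 / 4, 3 / 8⟩]).isSome
      = true := by
  decide +kernel

end Summit.CriticalPhenomena.Ising3D
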